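/-
HONEST FRAMING: certified error envelopes and provably optimal rounding/accumulation schemes for
low-precision formats under stated cost models; every table by two implementations; no hardware
or vendor claims.
-/
import Summits.Ventures.CertifiedArithmetic.LowPrec.OptDemotionBudgetCert

/-!
# The demotion law (Theorem T8), part 7f(C): kernel certificates for EIGHT summands at (q,p) = (4,2), blocks 10–14

`decide +kernel` evaluations of `budgetCheck 4 2` (part 7c) on the 429 ordered shapes with 8 leaves,
cut into 20 blocks of 22 shapes (`chunk`, part 7d; ≈ 1 minute of kernel time each): parts 7f(A),
7f(B), 7f(C) hold blocks 0–4, 5–9, 10–14; part 7f (`OptDemotionBudgetCert8`) holds blocks 15–19,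
the reassembly `budgetCheck_4_2_eight`, `budgetCheck_4_2_upTo8` (all 626 ordered shapes with at
most 8 leaves) and `conjectureD_4_2_of_le_eight`.
-/

namespace Summit.Ventures.CertifiedArithmetic.LowPrec.Opt

open Literature.ComputerArithmetic.JeannerodRump2018
open Literature.ComputerArithmetic.JeannerodRump2018.SumTree

/-- (4,2), the 429 shapes with 8 leaves, block 10 (shapes 220–241). -/
theorem budgetCheck_4_2_eight_10 : (chunk (shapesN 8) 22 10).all (budgetCheck 4 2) = true := by
  decide +kernel

/-- (4,2), the 429 shapes with 8 leaves, block 11 (shapes 242–263). -/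
theorem budgetCheck_4_2_eight_11 : (chunk (shapesN 8) 22 11).all (budgetCheck 4 2) = true := by
  decide +kernel

/-- (4,2), the 429 shapes with 8 leaves, block 12 (shapes 264–285). -/
theorem budgetCheck_4_2_eight_12 : (chunk (shapesN 8) 22 12).all (budgetCheck 4 2) = true := by
  decide +kernel

/-- (4,2), the 429 shapes with 8 leaves, block 13 (shapes 286–307). -/
theorem budgetCheck_4_2_eight_13 : (chunk (shapesN 8) 22 13).all (budgetCheck 4 2) = true := by
  decide +kernel

/-- (4,2), the 429 shapes with 8 leaves, block 14 (shapes 308–329). -/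
theorem budgetCheck_4_2_eight_14 : (chunk (shapesN 8) 22 14).all (budgetCheck 4 2) = true := by
  decide +kernel

end Summit.Ventures.CertifiedArithmetic.LowPrec.Opt
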